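import Mathlib
import Literature.Analysis.Calculus.ExpDuhamel

/-!
# T⁴ programme, spine node NE2 (U1a) — R14 W3 proper, file 6: THE FUNCTIONAL CALCULUS OF [B7] §A FOR (124)'s COEFFICIENT OPERATORS — `g(X) = Σ(−1)ⁿXⁿ/(n+1)!`, its size, its inverse,
# and the letters `‖G_i‖ = O(‖ad_Y‖ + ‖ad_{Y_x}‖)` (cell `pub-balaban-gaps`, seat ne2 gen 5)

[B7] (32)–(33) p. 22: «e^{−A(t)}(d/dt)e^{A(t)} = Σ_{n≥0} ((−1)ⁿ/(n+1)!)(ad_{A(t)})ⁿA′(t) = g(ad_{A(t)})A′(t)», «g(z) = Σ_{n=0}^∞ ((−1)ⁿ/(n+1)!) zⁿ = (e^{−z} − 1)/(−z) for z ≠ 0, g(0) = 1»;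
p. 22: «we will consider functions of this operator f(ad_X). For analytic functions f defined in a neighborhood of 0 and for X with a sufficiently small norm, the function f(ad_X) can be defined
by the power series expansion»; p. 36 (after (124)): «the functions g(−z), g⁻¹(z), e^{iz} are equal to 1 for z = 0, so the operators occurring in these terms can be estimated by O(L²α₀)».
THIS FILE supplies that remark as kernel bookkeeping in an arbitrary complete normed ℂ-algebra `𝔸` with `‖1‖ = 1` (the application: `𝔸 = Matrix o o ℂ` with the L²-operator norm, the
arguments being the matrices of `∓i ad_Y`, `∓i ad_{Y_x}` in a basis of the colour carrier — files 1–5 of W3 take the resulting coefficient operators as DATA with the letter `‖G_i‖ ≤ γ`):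
 * **`gFun X = Σ' n, ((−1)ⁿ/(n+1)!)•Xⁿ`** ((33)), `summable_gFun`, `gFun_zero = 1`, **`norm_gFun_sub_one_le`**: `‖g(X) − 1‖ ≤ e^{‖X‖} − 1`;
 * `‖exp X − 1‖ ≤ e^{‖X‖} − 1` is REUSED from the tree (`Literature.Analysis.Calculus.norm_exp_sub_one_le`, module `ExpDuhamel`);
 * **`norm_inv_sub_one_le_of_norm_sub_one_le`**: in a complete normed ring, `‖A − 1‖ ≤ δ < 1 ⟹ A` is a unit and `‖A⁻¹ − 1‖ ≤ δ/(1 − δ)` (Neumann series);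
 * §3 the three COEFFICIENT SHAPES of (124) — `G₁ = g(A)·g(B)⁻¹ − 1`, `G₂ = g(A)·g(B)⁻¹·exp(C) − 1`, `G₃ = exp(C) − g(A)·m` with `m` an average of inverses `g(B_x)⁻¹` — and their letters
   **`norm_coeff₁_le`**, **`norm_coeff₂_le`**, **`norm_coeff₃_le`**: for `‖A‖, ‖B‖, ‖B_x‖, ‖C‖ ≤ y ≤ 1/4`, each is `≤ 16·y` — print's `O(L²α₀)` with `y = O(L²α₀)` the size of the loop
   logarithms `Y, Y_x` ((116) p. 35: «|Y_x| = O(L²α₀)») times `‖ad‖ ≤ 2`.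
NOT here: the identification of `ad_Y` with a concrete `o×o` matrix of the tree's colour carrier and the lattice-Stokes letter `‖Y_x‖ = O(L²α₀)` from (3.35) (successor's W3c).
HONEST FRAMING (T4-DAG p. 1).  Elementary functional calculus; nothing of Bałaban's is asserted; NOT NE2; **NE2 (U1a) NOT PROVED**; spine PROVED 0/9 unchanged; NOT continuum YM / infinite volume /
mass gap / Clay.  No `sorry`.
-/

noncomputable section

open scoped BigOperators
open Nat NormedSpace

namespace Summit.QuantumFields.BalabanUV.T4Continuum.NE2.OneStepRemainderCoefficients

open Literature.Analysis.Calculus (norm_exp_sub_one_le)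

/-! ## §1 `g` and `exp` near `0` -/

section Calculus

variable {𝔸 : Type*} [NormedRing 𝔸] [NormedAlgebra ℂ 𝔸] [CompleteSpace 𝔸] [NormOneClass 𝔸]

/-- [B7] (33): `g(X) = Σ_{n≥0} ((−1)ⁿ/(n+1)!) Xⁿ` as a norm-convergent series. [cite: Balaban1985Averaging, (33) p.22] [folklore] -/
def gFun (X : 𝔸) : 𝔸 := ∑' n : ℕ, ((-1 : ℂ) ^ n / ((n + 1)! : ℂ)) • X ^ n

omit [CompleteSpace 𝔸] in
/-- the `n`-th term of `g` is dominated by the exponential series: `‖((−1)ⁿ/(n+1)!)Xⁿ‖ ≤ ‖X‖ⁿ/n!`. [folklore] -/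
theorem norm_gTerm_le (X : 𝔸) (n : ℕ) : ‖((-1 : ℂ) ^ n / ((n + 1)! : ℂ)) • X ^ n‖ ≤ ‖X‖ ^ n / (n ! : ℝ) := by
  rw [norm_smul, norm_div, norm_pow, norm_neg, norm_one, one_pow, Complex.norm_natCast, div_eq_mul_inv, one_mul]
  have hfac : ((n ! : ℝ))⁻¹ ≥ 0 := by positivity
  have h1 : (((n + 1)! : ℕ) : ℝ)⁻¹ ≤ ((n ! : ℕ) : ℝ)⁻¹ := by
    apply inv_anti₀ (by positivity)
    exact_mod_cast Nat.factorial_le (Nat.le_succ n)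
  calc (((n + 1)! : ℕ) : ℝ)⁻¹ * ‖X ^ n‖ ≤ ((n ! : ℕ) : ℝ)⁻¹ * ‖X‖ ^ n :=
        mul_le_mul h1 (norm_pow_le X n) (norm_nonneg _) hfac
    _ = ‖X‖ ^ n / (n ! : ℝ) := by rw [div_eq_mul_inv, mul_comm]

/-- the series of `g` converges absolutely. [folklore] -/
theorem summable_gFun (X : 𝔸) : Summable (fun n : ℕ => ((-1 : ℂ) ^ n / ((n + 1)! : ℂ)) • X ^ n) :=
  Summable.of_norm_bounded (Real.summable_pow_div_factorial ‖X‖) (norm_gTerm_le X)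

omit [CompleteSpace 𝔸] [NormOneClass 𝔸] in
/-- `g(0) = 1`. [cite: Balaban1985Averaging, (33) p.22] [folklore] -/
theorem gFun_zero : gFun (0 : 𝔸) = 1 := by
  rw [gFun, tsum_eq_single 0]
  · simp
  · intro n hn
    rw [zero_pow hn, smul_zero]

/-- **`‖g(X) − 1‖ ≤ e^{‖X‖} − 1`**. [cite: Balaban1985Averaging, p.36 (the remark after (124))] [folklore] -/
theorem norm_gFun_sub_one_le (X : 𝔸) : ‖gFun X - 1‖ ≤ Real.exp ‖X‖ - 1 := by
  have hs := summable_gFun X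
  have hsn : Summable (fun n : ℕ => ‖X‖ ^ n / (n ! : ℝ)) := Real.summable_pow_div_factorial ‖X‖
  have h0 : ((-1 : ℂ) ^ 0 / ((0 + 1)! : ℂ)) • X ^ 0 = 1 := by simp
  have hsplit : gFun X - 1 = ∑' n : ℕ, ((-1 : ℂ) ^ (n + 1) / ((n + 1 + 1)! : ℂ)) • X ^ (n + 1) := by
    rw [gFun, hs.tsum_eq_zero_add, h0, add_sub_cancel_left]
  have hexp : Real.exp ‖X‖ - 1 = ∑' n : ℕ, ‖X‖ ^ (n + 1) / ((n + 1)! : ℝ) := by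
    have h := (expSeries_div_hasSum_exp (𝔸 := ℝ) ‖X‖).tsum_eq
    rw [← Real.exp_eq_exp_ℝ] at h
    rw [← h, hsn.tsum_eq_zero_add]
    simp
  rw [hsplit, hexp]
  refine tsum_of_norm_bounded ((summable_nat_add_iff 1).mpr hsn).hasSum fun n => ?_
  have := norm_gTerm_le X (n + 1)
  simpa [Nat.cast_add, Nat.cast_one, add_assoc] using this

-- `‖exp X − 1‖ ≤ e^{‖X‖} − 1` is the tree's `Literature.Analysis.Calculus.norm_exp_sub_one_le` (module `ExpDuhamel`), reused below.

end Calculus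

/-! ## §2 Inverses near the identity (Neumann series) -/

section Neumann

variable {𝔸 : Type*} [NormedRing 𝔸] [CompleteSpace 𝔸] [NormOneClass 𝔸]

omit [NormOneClass 𝔸] in
/-- **NEUMANN**: `‖A − 1‖ ≤ δ < 1` makes `A` a unit with `‖A⁻¹ − 1‖ ≤ δ/(1 − δ)`. [folklore] -/
theorem norm_inverse_sub_one_le {A : 𝔸} {δ : ℝ} (hA : ‖A - 1‖ ≤ δ) (hδ : δ < 1) :
    IsUnit A ∧ ‖Ring.inverse A - 1‖ ≤ δ / (1 - δ) := by
  set t : 𝔸 := 1 - A with ht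
  have htn : ‖t‖ ≤ δ := by rw [ht, ← norm_neg, neg_sub]; exact hA
  have ht1 : ‖t‖ < 1 := htn.trans_lt hδ
  have hδ0 : 0 ≤ δ := (norm_nonneg _).trans htn
  have hA1 : A = 1 - t := by rw [ht, sub_sub_cancel]
  have hunit : IsUnit A := by rw [hA1]; exact (Units.oneSub t ht1).isUnit
  refine ⟨hunit, ?_⟩
  have hinv : Ring.inverse A = ∑' n : ℕ, t ^ n := by rw [hA1, ← geom_series_eq_inverse t ht1]
  have hsum : Summable (fun n : ℕ => t ^ n) := summable_geometric_of_norm_lt_one ht1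
  have hsplit : (∑' n : ℕ, t ^ n) - 1 = ∑' n : ℕ, t ^ (n + 1) := by
    rw [hsum.tsum_eq_zero_add, pow_zero, add_sub_cancel_left]
  rw [hinv, hsplit]
  have hbound : ∀ n : ℕ, ‖t ^ (n + 1)‖ ≤ δ ^ (n + 1) := fun n => (norm_pow_le' t (Nat.succ_pos n)).trans (pow_le_pow_left₀ (norm_nonneg _) htn _)
  have hδs : HasSum (fun n : ℕ => δ ^ (n + 1)) (δ / (1 - δ)) := by
    have h := (hasSum_geometric_of_lt_one hδ0 hδ).mul_left δ
    have h' : (fun n : ℕ => δ ^ (n + 1)) = fun i => δ * δ ^ i := funext fun n => pow_succ' δ n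
    rw [div_eq_mul_inv, h']
    exact h
  exact tsum_of_norm_bounded hδs hbound

end Neumann

/-! ## §3 The three coefficient shapes of (124) and their letters -/

section Coeff

variable {𝔸 : Type*} [NormedRing 𝔸] [NormedAlgebra ℂ 𝔸] [CompleteSpace 𝔸] [NormOneClass 𝔸]

/-- `e^y − 1 ≤ 2y` for `0 ≤ y ≤ 1/4` (crude). [folklore] -/
theorem exp_sub_one_le_two_mul {y : ℝ} (hy0 : 0 ≤ y) (hy : y ≤ 1 / 4) : Real.exp y - 1 ≤ 2 * y := by
  have h := Real.add_one_le_exp (-y)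
  have h2 : Real.exp y * Real.exp (-y) = 1 := by rw [← Real.exp_add, add_neg_cancel, Real.exp_zero]
  have hpos := Real.exp_pos y
  -- e^y ≤ 1/(1 − y) ≤ 1 + 2y for y ≤ 1/2
  have h3 : Real.exp y * (1 - y) ≤ 1 := by nlinarith
  nlinarith

omit [NormedAlgebra ℂ 𝔸] [CompleteSpace 𝔸] [NormOneClass 𝔸] in
/-- a product of two near-identity elements is near the identity. [folklore] -/
theorem norm_mul_sub_one_le {P Q : 𝔸} {p q : ℝ} (hP : ‖P - 1‖ ≤ p) (hQ : ‖Q - 1‖ ≤ q) : ‖P * Q - 1‖ ≤ (1 + p) * (1 + q) - 1 := by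
  have hp : 0 ≤ p := (norm_nonneg _).trans hP
  have e : P * Q - 1 = (P - 1) * (Q - 1) + (P - 1) + (Q - 1) := by noncomm_ring
  rw [e]
  calc ‖(P - 1) * (Q - 1) + (P - 1) + (Q - 1)‖ ≤ ‖P - 1‖ * ‖Q - 1‖ + ‖P - 1‖ + ‖Q - 1‖ :=
        (norm_add₃_le).trans (add_le_add (add_le_add (norm_mul_le _ _) le_rfl) le_rfl)
    _ ≤ p * q + p + q := by gcongr
    _ = (1 + p) * (1 + q) - 1 := by ring

/-- **THE FIRST COEFFICIENT** `G₁ = g(A)·g(B)⁻¹ − 1` (print: `A = −i ad_Y`, `B = −i ad_{Y_x}`): for `‖A‖, ‖B‖ ≤ y ≤ 1/4`, `‖G₁‖ ≤ 16·y`.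
[cite: Balaban1985Averaging, (124) p.36] [folklore] -/
theorem norm_coeff₁_le {A B : 𝔸} {y : ℝ} (hy0 : 0 ≤ y) (hy : y ≤ 1 / 4) (hA : ‖A‖ ≤ y) (hB : ‖B‖ ≤ y) :
    ‖gFun A * Ring.inverse (gFun B) - 1‖ ≤ 16 * y := by
  have hgA : ‖gFun A - 1‖ ≤ 2 * y :=
    (norm_gFun_sub_one_le A).trans ((sub_le_sub_right (Real.exp_le_exp.mpr hA) 1).trans (exp_sub_one_le_two_mul hy0 hy))
  have hgB : ‖gFun B - 1‖ ≤ 2 * y :=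
    (norm_gFun_sub_one_le B).trans ((sub_le_sub_right (Real.exp_le_exp.mpr hB) 1).trans (exp_sub_one_le_two_mul hy0 hy))
  have h2y : 2 * y < 1 := by linarith
  have hinv := (norm_inverse_sub_one_le hgB h2y).2
  have hinv' : ‖Ring.inverse (gFun B) - 1‖ ≤ 4 * y := by
    refine hinv.trans ?_
    rw [div_le_iff₀ (by linarith)]
    nlinarith
  refine (norm_mul_sub_one_le hgA hinv').trans ?_
  nlinarith [mul_le_mul_of_nonneg_left hy hy0]

/-- **THE SECOND COEFFICIENT** `G₂ = g(A)·g(B)⁻¹·exp(C) − 1` (print: `A = −i ad_Y`, `B = i ad_{Y_x}`, `C = −i ad_Y`): for `‖A‖, ‖B‖, ‖C‖ ≤ y ≤ 1/4`, `‖G₂‖ ≤ 16·y`.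
[cite: Balaban1985Averaging, (124) p.36] [folklore] -/
theorem norm_coeff₂_le {A B C : 𝔸} {y : ℝ} (hy0 : 0 ≤ y) (hy : y ≤ 1 / 4) (hA : ‖A‖ ≤ y) (hB : ‖B‖ ≤ y) (hC : ‖C‖ ≤ y) :
    ‖gFun A * Ring.inverse (gFun B) * exp C - 1‖ ≤ 16 * y := by
  have hgA : ‖gFun A - 1‖ ≤ 2 * y :=
    (norm_gFun_sub_one_le A).trans ((sub_le_sub_right (Real.exp_le_exp.mpr hA) 1).trans (exp_sub_one_le_two_mul hy0 hy))
  have hgB : ‖gFun B - 1‖ ≤ 2 * y :=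
    (norm_gFun_sub_one_le B).trans ((sub_le_sub_right (Real.exp_le_exp.mpr hB) 1).trans (exp_sub_one_le_two_mul hy0 hy))
  have heC : ‖exp C - 1‖ ≤ 2 * y :=
    (norm_exp_sub_one_le C).trans ((sub_le_sub_right (Real.exp_le_exp.mpr hC) 1).trans (exp_sub_one_le_two_mul hy0 hy))
  have h2y : 2 * y < 1 := by linarith
  have hinv' : ‖Ring.inverse (gFun B) - 1‖ ≤ 4 * y := by
    refine (norm_inverse_sub_one_le hgB h2y).2.trans ?_
    rw [div_le_iff₀ (by linarith)]
    nlinarith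
  refine (norm_mul_sub_one_le (norm_mul_sub_one_le hgA hinv') heC).trans ?_
  have h1 : y * y ≤ y * (1 / 4) := mul_le_mul_of_nonneg_left hy hy0
  have h2 : y * y * y ≤ y * (1 / 4) * (1 / 4) := by nlinarith [mul_nonneg hy0 hy0]
  nlinarith [mul_nonneg hy0 hy0, mul_nonneg (mul_nonneg hy0 hy0) hy0]

/-- **THE THIRD COEFFICIENT** `G₃ = exp(C) − g(A)·m`, `m = Σ_x w_x g(B_x)⁻¹` a weighted average (`w_x ≥ 0`, `Σ w_x = 1`; print: `w_x = L^{−d}`, `C = i ad_Y`, `A = −i ad_Y`, `B_x = i ad_{Y_x}`):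
for `‖A‖, ‖C‖, ‖B_x‖ ≤ y ≤ 1/4`, `‖G₃‖ ≤ 16·y`. [cite: Balaban1985Averaging, (124) p.36] [folklore] -/
theorem norm_coeff₃_le {ι : Type*} (s : Finset ι) {w : ι → ℝ} (hw0 : ∀ x ∈ s, 0 ≤ w x) (hw1 : ∑ x ∈ s, w x = 1)
    {A C : 𝔸} {B : ι → 𝔸} {y : ℝ} (hy0 : 0 ≤ y) (hy : y ≤ 1 / 4) (hA : ‖A‖ ≤ y) (hC : ‖C‖ ≤ y) (hB : ∀ x ∈ s, ‖B x‖ ≤ y) :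
    ‖exp C - gFun A * ∑ x ∈ s, (w x : ℂ) • Ring.inverse (gFun (B x))‖ ≤ 16 * y := by
  have hgA : ‖gFun A - 1‖ ≤ 2 * y :=
    (norm_gFun_sub_one_le A).trans ((sub_le_sub_right (Real.exp_le_exp.mpr hA) 1).trans (exp_sub_one_le_two_mul hy0 hy))
  have heC : ‖exp C - 1‖ ≤ 2 * y :=
    (norm_exp_sub_one_le C).trans ((sub_le_sub_right (Real.exp_le_exp.mpr hC) 1).trans (exp_sub_one_le_two_mul hy0 hy))
  have h2y : 2 * y < 1 := by linarith
  have hinv : ∀ x ∈ s, ‖Ring.inverse (gFun (B x)) - 1‖ ≤ 4 * y := by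
    intro x hx
    have hgB : ‖gFun (B x) - 1‖ ≤ 2 * y :=
      (norm_gFun_sub_one_le (B x)).trans ((sub_le_sub_right (Real.exp_le_exp.mpr (hB x hx)) 1).trans (exp_sub_one_le_two_mul hy0 hy))
    refine (norm_inverse_sub_one_le hgB h2y).2.trans ?_
    rw [div_le_iff₀ (by linarith)]
    nlinarith
  -- the average is within `4y` of the identity
  have hsum1 : ∑ x ∈ s, (w x : ℂ) • (1 : 𝔸) = 1 := by
    rw [← Finset.sum_smul, ← Complex.ofReal_sum, hw1, Complex.ofReal_one, one_smul]
  have hm : ‖(∑ x ∈ s, (w x : ℂ) • Ring.inverse (gFun (B x))) - 1‖ ≤ 4 * y := by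
    have e : (∑ x ∈ s, (w x : ℂ) • Ring.inverse (gFun (B x))) - 1 = ∑ x ∈ s, (w x : ℂ) • (Ring.inverse (gFun (B x)) - 1) := by
      conv_lhs => rw [← hsum1]
      rw [← Finset.sum_sub_distrib]
      exact Finset.sum_congr rfl fun x _ => (smul_sub _ _ _).symm
    rw [e]
    calc ‖∑ x ∈ s, (w x : ℂ) • (Ring.inverse (gFun (B x)) - 1)‖ ≤ ∑ x ∈ s, ‖(w x : ℂ) • (Ring.inverse (gFun (B x)) - 1)‖ := norm_sum_le _ _
      _ ≤ ∑ x ∈ s, w x * (4 * y) := Finset.sum_le_sum fun x hx => by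
          rw [norm_smul, Complex.norm_real, Real.norm_of_nonneg (hw0 x hx)]
          exact mul_le_mul_of_nonneg_left (hinv x hx) (hw0 x hx)
      _ = 4 * y := by rw [← Finset.sum_mul, hw1, one_mul]
  have hprod : ‖gFun A * (∑ x ∈ s, (w x : ℂ) • Ring.inverse (gFun (B x))) - 1‖ ≤ (1 + 2 * y) * (1 + 4 * y) - 1 := norm_mul_sub_one_le hgA hm
  have e : exp C - gFun A * ∑ x ∈ s, (w x : ℂ) • Ring.inverse (gFun (B x)) = (exp C - 1) - (gFun A * (∑ x ∈ s, (w x : ℂ) • Ring.inverse (gFun (B x))) - 1) := by abel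
  rw [e]
  refine (norm_sub_le _ _).trans ?_
  nlinarith [mul_nonneg hy0 hy0, mul_le_mul_of_nonneg_left hy hy0]

end Coeff

end Summit.QuantumFields.BalabanUV.T4Continuum.NE2.OneStepRemainderCoefficients

end
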